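import Summits.Parity.GeneralizedHardyLittlewood.Theses.FordMaynardNoSieveConst0164
import Literature.NumberTheory.Sieve.FordMaynardNoLowerSieveConst

/-!
# Route `FordMaynardNoSieveConst0164` — support item `NonposOfPrimeFree` (stmt-Parity-19104), closed

`NonposOfPrimeFree := ∀ γ θ ν c, (∀ B, 0 < B → PrimeFreeAdmissible γ θ ν B) → IsLowerSieveConst γ θ ν c → c ≤ 0`
(Ford–Maynard's reading `C⁻(P) = 0`, arXiv:2407.14368 Definition 4.8: if for every `B > 0` some
`(γ, θ, ν)`-admissible weight sequence of mass `≥ B` is prime-free, no positive lower-sieve constant exists) IS the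
landed Literature theorem `Literature.NumberTheory.Sieve.FordMaynard.IsLowerSieveConst.nonpos_of_primeFreeAdmissible`
(p405250) with its binders made explicit — one application.  Candidate term of record: planner p3 evidence
`NonposOfPrimeFree_holds.lean` (pub/parity-ideate/parity-ideate-p3/evidence2/, sha16 fede77ee3d3109d9; registered
variant c038246844a7c872), refuter candidate `NonposProof.lean` a7aa757685dbb71f (2026-08-27, same term); landed verbatim
(docstrings added) by the decomp-parity landing hand leafhand-parity-fmcert-1 g0 once
`Literature.NumberTheory.Sieve.FordMaynardNoLowerSieveConst` was in the farm build (BUILT 2026-08-31T07:26Z).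
Rung F-P1; no summit motion.  Standard axioms only.
-/

namespace Summit.Parity.GeneralizedHardyLittlewood.Theses.FordMaynardNoSieveConst0164

/-- **`NonposOfPrimeFree` holds** (route `FordMaynardNoSieveConst0164`, support stmt-Parity-19104):
prime-free admissible sequences of every mass force every lower-sieve constant at `(γ, θ, ν)` to be `≤ 0` —
`IsLowerSieveConst.nonpos_of_primeFreeAdmissible`, ∀-closed. -/
theorem nonposOfPrimeFree_holds : Summit.Parity.GeneralizedHardyLittlewood.Theses.FordMaynardNoSieveConst0164.NonposOfPrimeFree :=
  fun _γ _θ _ν _c hpf hc =>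
    Literature.NumberTheory.Sieve.FordMaynard.IsLowerSieveConst.nonpos_of_primeFreeAdmissible hpf hc

end Summit.Parity.GeneralizedHardyLittlewood.Theses.FordMaynardNoSieveConst0164
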